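import Summits.QuantumFields.YangMills.Theorems.BalabanUVNodesN15KingModelPotentialLipschitz

/-!
# Route «BalabanUVNodes» (K4 «SpineRates»), node N15 = NE2 — THE KING-MODEL RUNG, part 9c: KING'S TOWER FULLY DRESSED BY A POTENTIAL TOWER, BY NAME —
# locality of `j ↦ Δ^{(j)}_{v_j}` along the run, the (3.35) letter of the FULL perturbation `Δ^{(j)}_{v_j} − Δ^{(j)}` DERIVED, `potTower v` (part 8a) =
# the full perturbation up to a LOCAL `O(sup|v|²)`, and the fully dressed covariances: local and Lipschitz in the potential at every level

Cell `pub-ymgap`, Track A (D-0062), seat `pub-ymgap-dag-n15-d` (R134 seat, strategy s3, gen 7).  `bears_on: R4∕N15`; `--supports` the K3‴ item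
`SpineGivenEndpointR13` (stmt-QuantumFields-19912).  COUNT-NEUTRAL.  Imports part 9b (hence 9a, 8d, 8a, 7c…3).  Objects: `kingTowerPot` (the ℕ-tower
`j ↦ Δ^{(max j 1)}_{v}` = part 8d's `kingLevelPot` along King's run `N = L^k`, `a_k = aK a L k`), `fullPert = kingTowerPot − kingTower` (the FULL
perturbation tower), and three constants (`ctCK`, `kwSum`, `wbarK`).

WHAT THIS FILE PROVES (kernel; `L ≥ 2`, `a, m² > 0`, any torus `Π ℤ∕(LM_μ)`; `κ′ = kapCT` = the lineage's Combes–Thomas rate; the potential tower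
`v = (v_N)_N` obeys `sup_N,x |v_N(x)| ≤ w₁ ≤ w̄ = γ_A(a(1−L⁻²))∕4` — a UNIFORM window, no smallness in `k`, the volume or `m²`).
* §1 UNIFORMITY ALONG THE RUN (`gap_unif`): at every level `k ≥ 1` the block Combes–Thomas rate `κ = 4κ′ ≤ κ_U` and the window `w̄` satisfy 9a's gap
  `w̄ + (2d + a_k)κ² < γ_A(a_k)` with `ctC a_k w̄ κ d ≤ ctCK = (4∕γ_A(a_min))e²` (monotonicity of `γ_A`, `a_min ≤ a_k ≤ a`).
* §2 ★ **`uniformKernelDecay_kingTowerPot`** — (H2′) FOR THE FULLY DRESSED TOWER: `|Δ^{(max j 1)}_{v}(z,w)| ≤ (a + a²·ctCK)·e^{−2κ′|z−w|_T}` at every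
  level (9a's `effLaplacianPot_entry_le`); ★★ **`uniformKernelDecay_fullPert`** — THE (3.35) LETTER OF THE FULL PERTURBATION, DERIVED:
  `UniformKernelDecay (fullPert v) tdistT (a²·ctCK²·kwSum·w₁) κ′` (9b's `effLaplacianPot_lipschitz` at `w′ = 0`) — part 6b's `Reg335` slot, which parts
  6–8 carried as a READING or to first order, is now a THEOREM for the nonperturbatively dressed King tower; ★ **`fullPert_sub_potTower_le`** — part 8a's
  first-variation tower IS the full perturbation up to a local second-order remainder: `|fullPert v j − potTower v j|(z,w) ≤ a²·ctCK³·KW²·w₁²·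
  e^{−2κ′|z−w|_T}` (9b's `effLaplacianPot_taylor2_minimiser_le` + the identification `potLevel = N^{−d}Σψwψ` by uniqueness of derivatives,
  `potLevel_eq_sandwich`, from 8d's two `HasDerivAt` theorems).
* §3 THE FULLY DRESSED COVARIANCES `C_v^{(j)} = (Δ^{(max j 1)}_{v} + aL⁻²Q*Q)⁻¹` BY NAME (`kingCovE (fullPert v)` of part 6b = `(kingTowerPot v j +
  kingBlock)⁻¹`, `kingCovE_fullPert`): with `c_E := a²·ctCK²·kwSum·w₁ ≤ c̄` (6b's `kingCbar`), ★ `uniformCoercive_kingTowerPot` ∕ `uniformCTBound_kingTowerPot`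
  (6a's perturbation lemmas fired on the derived letter), ★ **`kingCovPot_decay`** (`|C_v^{(j)}(x,y)| ≤ (4∕γ₀)e^{−κ′|x−y|_T}`, part 5's
  `inv_entry_decay_of_leaves`), ★★ **`kingCovPot_lipschitz`** (`|C^{(j)}(x,y) − C_v^{(j)}(x,y)| ≤ c_E·Λ_K·e^{−δ₄₅|x−y|_T}` — 6b's `kingCovE_lipschitz`
  FIRED: the covariances of King's tower FULLY dressed by a potential are Lipschitz in the potential AT EVERY LEVEL with decay; position-space NE2-LIP
  station, nonperturbative).

HONEST FRAMING ∕ LIMITS.  King's `A = 0` SCALAR block-spin construction (periodic b.c., flat blocks, `k ≥ 1` with the ℕ-tower constant below 1); a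
potential is NOT a gauge field; the (H3) two-spacing RATE letter of the full dressed tower — hence (4.38) ∕ `NE2PlusUnit` for it — is NOT proved
(first-order only, parts 8a–8c; nonperturbatively it needs the `A = 0` instance of King's Prop. 3.9, not in the tree); nothing here is Bałaban's
`Δ^{(k)}(U) − Δ^{(k)}(1)`, `G(U)`, `C^{(k)}(Λ;U)` (η-differences NOT PRINTED); NOT a node discharge; typed 28∕28, discharged count untouched; one finite
torus at fixed ε — NOT ℝ⁴ ∕ infinite volume ∕ OS ∕ mass gap ∕ Clay.  Locators: [King1986] = C. King, CMP **102** (1986) 649–677: (2.13)–(2.15) p. 653,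
(4.32)–(4.34) p. 674, (4.37)–(4.41) pp. 674–675; [Dimock2013] = J. Dimock, Rev. Math. Phys. **25** (2013) 1330010, App. D L. 29–30.
-/

noncomputable section

open scoped BigOperators Matrix
open Finset

namespace Summit.QuantumFields.YangMills.BalabanUVNodes.N15.KingModel

open Literature.MathematicalPhysics.QuantumFieldTheory.Balaban1983to89 hiding blockOf
open Literature.MathematicalPhysics.QuantumFieldTheory.Balaban1983to89.QGQInverse (Coercive)
open Literature.MathematicalPhysics.QuantumFieldTheory.Balaban1983to89.B4Sect5Proof (latticeConst latticeConst_nonneg)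
open Literature.MathematicalPhysics.QuantumFieldTheory.Balaban1983to89.B5Prop11Plancherel (Tor fine)
open Literature.MathematicalPhysics.QuantumFieldTheory.King1986 (aK aK_pos exp_decay_mono)
open Literature.MathematicalPhysics.QuantumFieldTheory.King1986.Torus
open Summit.QuantumFields.BalabanUV.T4Continuum.NE2KingTransplant (IsPseudoMetric UniformCoercive UniformCTBound UniformKernelDecay VolumeSum)

variable {d : ℕ}

/-! ## §1 The objects and the uniformity of 9a's constants along King's run -/

section Objects

variable (a m2 : ℝ) (L : ℕ) [NeZero L] (M : Fin (d + 1) → ℕ) [∀ μ, NeZero (M μ)]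

/-- **KING'S TOWER FULLY DRESSED BY A POTENTIAL TOWER** `v = (v_N)_N`: level `j` is `Δ^{(max j 1)}_{v_{L^{max j 1}}}` (part 8d's `kingLevelPot` along the
run; constant below level 1 like the lineage's `kingTower`). [cite: King1986, (2.13)–(2.14) p.653, (4.32) p.674 (the undressed tower, A = 0)] -/
def kingTowerPot (v : ∀ N : ℕ, Tor (fine N (fine L M)) → ℝ) : ℕ → Matrix (Tor (fine L M)) (Tor (fine L M)) ℝ :=
  fun j => kingLevelPot a m2 L M (max j 1) (v (L ^ max j 1))

/-- **THE FULL PERTURBATION TOWER** `E_j(v) = Δ^{(max j 1)}_{v} − Δ^{(max j 1)}` (no first-order truncation; part 8a's `potTower v` is its first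
variation). [cite: King1986, (2.14) p.653] -/
def fullPert (v : ∀ N : ℕ, Tor (fine N (fine L M)) → ℝ) : ℕ → Matrix (Tor (fine L M)) (Tor (fine L M)) ℝ :=
  kingTowerPot a m2 L M v - kingTower a m2 L M

/-- THE UNIFORM BLOCK CONSTANT along the run: `ctCK = (4∕γ_A(a_min))·e²` (`a_min = a(1 − L⁻²)`). [folklore] -/
def ctCK (dd : ℕ) (a : ℝ) (L : ℕ) : ℝ := 4 / gamA (aminL a L) dd * Real.exp 2

/-- THE LATTICE SUM at the dressed rate: `kwSum = K_d(2κ′)`. [folklore] -/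
def kwSum (dd : ℕ) (a : ℝ) (L : ℕ) : ℝ := latticeConst dd (2 * kapCT dd a L)

/-- THE POTENTIAL WINDOW `w̄ = γ_A(a_min)∕4` (uniform in `k`, the volume and `m²`). [folklore] -/
def wbarK (dd : ℕ) (a : ℝ) (L : ℕ) : ℝ := gamA (aminL a L) dd / 4

variable {a m2 L M}

/-- From level 1 on the dressed tower is `Δ^{(j)}_{v_{L^j}}`. [folklore] -/
theorem kingTowerPot_of_one_le (v : ∀ N : ℕ, Tor (fine N (fine L M)) → ℝ) {j : ℕ} (hj : 1 ≤ j) :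
    kingTowerPot a m2 L M v j = kingLevelPot a m2 L M j (v (L ^ j)) := by
  have h : ∀ n : ℕ, n = j → kingLevelPot a m2 L M n (v (L ^ n)) = kingLevelPot a m2 L M j (v (L ^ j)) := by
    rintro n rfl; rfl
  exact h _ (max_eq_left hj)

omit [NeZero L] [∀ μ, NeZero (M μ)] in
/-- `1 < L` as reals, for `L ≥ 2`. [folklore] -/
theorem one_lt_cast_of_two_le (hL : 2 ≤ L) : (1 : ℝ) < L := by exact_mod_cast (by omega : 1 < L)

/-- `Δ + E(v) = Δ_v` (the full perturbation dresses the tower exactly). [folklore] -/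
theorem kingTower_add_fullPert (v : ∀ N : ℕ, Tor (fine N (fine L M)) → ℝ) : kingTower a m2 L M + fullPert a m2 L M v = kingTowerPot a m2 L M v := by
  rw [fullPert]; abel

/-- Levelwise: `E_j(v) = Δ^{(max j 1)}_{v} − Δ^{(max j 1)}`, with the undressed level written as `kingLevelPot … 0`. [folklore] -/
theorem fullPert_apply (v : ∀ N : ℕ, Tor (fine N (fine L M)) → ℝ) (j : ℕ) :
    fullPert a m2 L M v j = kingLevelPot a m2 L M (max j 1) (v (L ^ max j 1)) - kingLevelPot a m2 L M (max j 1) 0 := by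
  rw [fullPert, Pi.sub_apply, kingTowerPot]
  congr 1
  exact (kingLevelPot_zero (a := a) (m2 := m2) (L := L) (M := M) (max j 1)).symm

omit [NeZero L] in
/-- `ctCK ≥ 0`, `kwSum ≥ 0`, `w̄ > 0`. [folklore] -/
theorem dressedConsts_nonneg (ha : 0 < a) (hL : 2 ≤ L) : 0 ≤ ctCK (d + 1) a L ∧ 0 ≤ kwSum (d + 1) a L ∧ 0 < wbarK (d + 1) a L := by
  have hγ := gamA_pos (aminL_pos ha hL) (d + 1)
  refine ⟨by unfold ctCK; positivity, latticeConst_nonneg (d + 1) (by have := (kapCT_pos_le (d := d + 1) ha hL).1; positivity), ?_⟩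
  unfold wbarK; positivity

omit [NeZero L] in
/-- **UNIFORMITY ALONG THE RUN**: at every `k ≥ 1`, with `κ = 4κ′` and any window `w₀ ≤ w̄`, 9a's gap holds at `a_k` and its constant is at most
`ctCK`; also `0 ≤ 4κ′ ≤ 1`. [cite: King1986, (2.13) p.653 (a(1 − L⁻²) ≤ a_k ≤ a)] -/
theorem gap_unif (ha : 0 < a) (hL : 2 ≤ L) {k : ℕ} (hk : 1 ≤ k) {w₀ : ℝ} (hw₀ : w₀ ≤ wbarK (d + 1) a L) :
    0 ≤ 4 * kapCT (d + 1) a L ∧ 4 * kapCT (d + 1) a L ≤ 1 ∧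
      w₀ + (2 * ((d + 1 : ℕ) : ℝ) + aK a L k) * (4 * kapCT (d + 1) a L) ^ 2 < gamA (aK a L k) (d + 1) ∧
      ctC (aK a L k) w₀ (4 * kapCT (d + 1) a L) (d + 1) ≤ ctCK (d + 1) a L := by
  have hamin := aminL_pos ha hL
  obtain ⟨hk1, hk2⟩ := aminL_le_aK ha hL hk
  obtain ⟨hκ0, hκ4⟩ := kapCT_pos_le (d := d + 1) ha hL
  obtain ⟨hU0, hU1⟩ := kapU_pos_le (d := d + 1) ha hamin
  have hκU : 4 * kapCT (d + 1) a L ≤ kapU (d + 1) a (aminL a L) := by linarith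
  have hγ := gamA_pos hamin (d + 1)
  have hγmono : gamA (aminL a L) (d + 1) ≤ gamA (aK a L k) (d + 1) := gamA_mono hk1 (d + 1)
  have hρ : (2 * ((d + 1 : ℕ) : ℝ) + aK a L k) * (4 * kapCT (d + 1) a L) ^ 2 ≤ gamA (aminL a L) (d + 1) / 2 := by
    have h1 : (4 * kapCT (d + 1) a L) ^ 2 ≤ kapU (d + 1) a (aminL a L) ^ 2 := pow_le_pow_left₀ (by linarith) hκU 2
    calc (2 * ((d + 1 : ℕ) : ℝ) + aK a L k) * (4 * kapCT (d + 1) a L) ^ 2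
        ≤ (2 * ((d + 1 : ℕ) : ℝ) + a) * kapU (d + 1) a (aminL a L) ^ 2 :=
          mul_le_mul (by linarith) h1 (sq_nonneg _) (by positivity)
      _ ≤ gamA (aminL a L) (d + 1) / 2 := rho_kapU_le ha hamin
  have hwb : w₀ ≤ gamA (aminL a L) (d + 1) / 4 := hw₀
  refine ⟨by linarith, by linarith, by linarith, ?_⟩
  unfold ctC ctCK
  have hgap : gamA (aminL a L) (d + 1) / 4 ≤ gamA (aK a L k) (d + 1) - w₀ - (2 * ((d + 1 : ℕ) : ℝ) + aK a L k) * (4 * kapCT (d + 1) a L) ^ 2 := by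
    linarith
  have hinv : (gamA (aK a L k) (d + 1) - w₀ - (2 * ((d + 1 : ℕ) : ℝ) + aK a L k) * (4 * kapCT (d + 1) a L) ^ 2)⁻¹
      ≤ 4 / gamA (aminL a L) (d + 1) := by
    rw [show (4 : ℝ) / gamA (aminL a L) (d + 1) = (gamA (aminL a L) (d + 1) / 4)⁻¹ by rw [inv_div]]
    exact inv_anti₀ (by positivity) hgap
  have hexp : Real.exp (2 * (4 * kapCT (d + 1) a L)) ≤ Real.exp 2 := Real.exp_le_exp.mpr (by linarith)
  have hq : (0 : ℝ) ≤ gamA (aminL a L) (d + 1) / 4 := by positivity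
  have h0 : 0 ≤ (gamA (aK a L k) (d + 1) - w₀ - (2 * ((d + 1 : ℕ) : ℝ) + aK a L k) * (4 * kapCT (d + 1) a L) ^ 2)⁻¹ :=
    inv_nonneg.mpr (hq.trans hgap)
  exact mul_le_mul hinv hexp (Real.exp_pos _).le (by positivity)

end Objects

/-! ## §2 The letters of the fully dressed tower: locality, the (3.35) letter of the full perturbation, and `potTower` = full perturbation + O(v²) -/

section Letters

variable {a m2 : ℝ} {L : ℕ} [NeZero L] {M : Fin (d + 1) → ℕ} [∀ μ, NeZero (M μ)]

/-- **(H2′) FOR THE FULLY DRESSED TOWER — `Δ^{(j)}_{v}` IS EXPONENTIALLY LOCAL AT EVERY LEVEL, uniformly**: for a potential tower with `v_N ≥ −w₀`,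
`w₀ ≤ w̄`: `UniformKernelDecay (kingTowerPot v) tdistT (a + a²·ctCK) κ′`. [cite: King1986, (4.34) p.674 (A = 0; here with the potential live); Dimock2013, App. D L.29–30] -/
theorem uniformKernelDecay_kingTowerPot (ha : 0 < a) (hm : 0 < m2) (hL : 2 ≤ L) {v : ∀ N : ℕ, Tor (fine N (fine L M)) → ℝ} {w₀ : ℝ}
    (hw₀ : w₀ ≤ wbarK (d + 1) a L) (hv : ∀ N x, -w₀ ≤ v N x) :
    UniformKernelDecay (kingTowerPot a m2 L M v) (tdistT (fine L M)) (a + a ^ 2 * ctCK (d + 1) a L) (kapCT (d + 1) a L) := by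
  intro j z w
  have hj : 1 ≤ max j 1 := le_max_right j 1
  obtain ⟨hκ0, hκ1, hgap, hC⟩ := gap_unif (d := d) ha hL hj hw₀
  have hak : 0 < aK a L (max j 1) := aK_pos ha (one_lt_cast_of_two_le hL) hj
  have h := effLaplacianPot_entry_le (N := L ^ max j 1) (U := fine L M) (m2 := m2) hak.le hm.le hκ0 hκ1 hgap (hv (L ^ max j 1)) z w
  have hCK := (dressedConsts_nonneg (d := d) ha hL).1
  have ht := (tdistT_isPseudoDist (fine L M)).nonneg z w
  calc |kingTowerPot a m2 L M v j z w| = |effLaplacianPot (L ^ max j 1) (fine L M) (aK a L (max j 1)) (((L ^ max j 1 : ℕ) : ℝ) ^ 2) m2 (v (L ^ max j 1)) z w| := rfl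
    _ ≤ (aK a L (max j 1) + aK a L (max j 1) ^ 2 * ctC (aK a L (max j 1)) w₀ (4 * kapCT (d + 1) a L) (d + 1))
          * Real.exp (-(4 * kapCT (d + 1) a L * tdistT (fine L M) z w)) := h
    _ ≤ (a + a ^ 2 * ctCK (d + 1) a L) * Real.exp (-(4 * kapCT (d + 1) a L * tdistT (fine L M) z w)) := by
          obtain ⟨-, hk2⟩ := aminL_le_aK ha hL hj
          have hC0 : 0 ≤ ctC (aK a L (max j 1)) w₀ (4 * kapCT (d + 1) a L) (d + 1) := ctC_nonneg (by exact_mod_cast hgap)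
          refine mul_le_mul_of_nonneg_right ?_ (Real.exp_pos _).le
          gcongr
    _ ≤ (a + a ^ 2 * ctCK (d + 1) a L) * Real.exp (-(2 * kapCT (d + 1) a L * tdistT (fine L M) z w)) :=
          exp_decay_mono (by positivity) (by linarith) ht

/-- **THE (3.35) LETTER OF THE FULL PERTURBATION, DERIVED — `Δ^{(j)}_{v} − Δ^{(j)}` is k-uniformly local with constant linear in `sup|v|`**: for
`sup_{N,x}|v_N(x)| ≤ w₁ ≤ w̄`, `UniformKernelDecay (fullPert v) tdistT (a²·ctCK²·kwSum·w₁) κ′` — part 6b's `Reg335` slot as a THEOREM for the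
nonperturbatively dressed King tower. [cite: King1986, (4.34), (4.37)–(4.38) p.674; Dimock2013, App. D L.30] -/
theorem uniformKernelDecay_fullPert (ha : 0 < a) (hm : 0 < m2) (hL : 2 ≤ L) {v : ∀ N : ℕ, Tor (fine N (fine L M)) → ℝ} {w₁ : ℝ}
    (hw₁ : w₁ ≤ wbarK (d + 1) a L) (hv : ∀ N x, |v N x| ≤ w₁) :
    UniformKernelDecay (fullPert a m2 L M v) (tdistT (fine L M)) (a ^ 2 * ctCK (d + 1) a L ^ 2 * kwSum (d + 1) a L * w₁) (kapCT (d + 1) a L) := by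
  intro j z w
  have hj : 1 ≤ max j 1 := le_max_right j 1
  set N := L ^ max j 1 with hN
  have hw₁0 : 0 ≤ w₁ := (abs_nonneg _).trans (hv N (site N (fine L M) z (j0 N)))
  obtain ⟨hκ0, hκ1, hgap, hC⟩ := gap_unif (d := d) ha hL hj hw₁
  have hκpos : 0 < 4 * kapCT (d + 1) a L := by have := (kapCT_pos_le (d := d + 1) ha hL).1; positivity
  have hak : 0 < aK a L (max j 1) := aK_pos ha (one_lt_cast_of_two_le hL) hj
  have hlo : ∀ x, -w₁ ≤ v N x := fun x => (abs_le.mp (hv N x)).1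
  have h0lo : ∀ x, -w₁ ≤ (0 : Tor (fine N (fine L M)) → ℝ) x := fun x => by rw [Pi.zero_apply]; linarith
  have hδ : ∀ x, |v N x - (0 : Tor (fine N (fine L M)) → ℝ) x| ≤ w₁ := fun x => by rw [Pi.zero_apply, sub_zero]; exact hv N x
  have h := effLaplacianPot_lipschitz (N := N) (U := fine L M) (m2 := m2) hak.le hm.le hκpos hκ1 hgap hlo h0lo hδ z w
  rw [fullPert_apply, Matrix.sub_apply]
  refine h.trans ?_
  have e : 4 * kapCT (d + 1) a L / 2 = 2 * kapCT (d + 1) a L := by ring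
  rw [e]
  refine mul_le_mul_of_nonneg_right ?_ (Real.exp_pos _).le
  obtain ⟨-, hk2⟩ := aminL_le_aK ha hL hj
  have hC0 : 0 ≤ ctC (aK a L (max j 1)) w₁ (4 * kapCT (d + 1) a L) (d + 1) := ctC_nonneg (by exact_mod_cast hgap)
  have hK : latticeConst (d + 1) (2 * kapCT (d + 1) a L) = kwSum (d + 1) a L := rfl
  rw [hK]
  have hKW := (dressedConsts_nonneg (d := d) ha hL).2.1
  gcongr

/-- **`potLevel` IS the `ψwψ` sandwich**: by uniqueness of derivatives from part 8d's two `HasDerivAt` theorems,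
`potLevel L (fine L M) a m² (L^k) k w b b′ = N^{−d}Σ_z ψ_{δ_b}(z)w(z)ψ_{δ_{b′}}(z)` (`N = L^k`, `ψ` King's minimiser at `a_k`). [cite: King1986, (2.13)–(2.15) p.653] -/
theorem potLevel_eq_sandwich (hL : 2 ≤ L) (ha : 0 < a) (hm : 0 < m2) {k : ℕ} (hk : 1 ≤ k) (w : Tor (fine (L ^ k) (fine L M)) → ℝ)
    (b b' : Tor (fine L M)) :
    potLevel L (fine L M) a m2 (L ^ k) k w b b'
      = ((((L ^ k : ℕ) : ℕ) : ℝ) ^ (d + 1))⁻¹ * ∑ z, minimiser (L ^ k) (fine L M) (aK a L k) (((L ^ k : ℕ) : ℝ) ^ 2) m2 (Pi.single b 1) z * w z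
          * minimiser (L ^ k) (fine L M) (aK a L k) (((L ^ k : ℕ) : ℝ) ^ 2) m2 (Pi.single b' 1) z := by
  have h1 := hasDerivAt_kingLevelPot_apply (M := M) hL ha hm hk w b b'
  have h2 := hasDerivAt_effLaplacianPot_apply (N := L ^ k) (U := fine L M) (aK_pos ha (one_lt_cast_of_two_le hL) hk).le
    (by positivity : (0 : ℝ) ≤ ((L ^ k : ℕ) : ℝ) ^ 2) hm w b b'
  exact h1.unique h2

/-- **PART 8a's FIRST-VARIATION TOWER IS THE FULL PERTURBATION UP TO A LOCAL `O(sup|v|²)`**: for `sup|v| ≤ w₁ ≤ w̄`, at every level and all sites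
`|fullPert v j (z,w) − potTower v j (z,w)| ≤ a²·ctCK³·KW²·w₁²·e^{−2κ′|z−w|_T}`. [cite: King1986, (2.13)–(2.15) p.653, (4.37)–(4.38) p.674] -/
theorem fullPert_sub_potTower_le (ha : 0 < a) (hm : 0 < m2) (hL : 2 ≤ L) {v : ∀ N : ℕ, Tor (fine N (fine L M)) → ℝ} {w₁ : ℝ}
    (hw₁ : w₁ ≤ wbarK (d + 1) a L) (hv : ∀ N x, |v N x| ≤ w₁) (j : ℕ) (z w : Tor (fine L M)) :
    |fullPert a m2 L M v j z w - potTower L (fine L M) a m2 v j z w|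
      ≤ a ^ 2 * ctCK (d + 1) a L ^ 3 * kwSum (d + 1) a L ^ 2 * w₁ ^ 2 * Real.exp (-(2 * kapCT (d + 1) a L * tdistT (fine L M) z w)) := by
  have hj : 1 ≤ max j 1 := le_max_right j 1
  set N := L ^ max j 1 with hN
  have hw₁0 : 0 ≤ w₁ := (abs_nonneg _).trans (hv N (site N (fine L M) z (j0 N)))
  obtain ⟨hκ0, hκ1, hgap, hC⟩ := gap_unif (d := d) ha hL hj hw₁
  have hκpos : 0 < 4 * kapCT (d + 1) a L := by have := (kapCT_pos_le (d := d + 1) ha hL).1; positivity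
  have hak : 0 < aK a L (max j 1) := aK_pos ha (one_lt_cast_of_two_le hL) hj
  have h := effLaplacianPot_taylor2_minimiser_le (N := N) (U := fine L M) (m2 := m2) hak.le hm.le hκpos hκ1 hgap (hv N) z w
  have hpot : potTower L (fine L M) a m2 v j z w = potLevel L (fine L M) a m2 (L ^ max j 1) (max j 1) (v (L ^ max j 1)) z w := rfl
  rw [hpot, potLevel_eq_sandwich hL ha hm hj, fullPert_apply, Matrix.sub_apply]
  have e0 : kingLevelPot a m2 L M (max j 1) (0 : Tor (fine N (fine L M)) → ℝ) = kingLevel a m2 L M (max j 1) := kingLevelPot_zero (max j 1)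
  rw [e0]
  refine h.trans ?_
  have e : 4 * kapCT (d + 1) a L / 2 = 2 * kapCT (d + 1) a L := by ring
  rw [e]
  refine mul_le_mul_of_nonneg_right ?_ (Real.exp_pos _).le
  obtain ⟨-, hk2⟩ := aminL_le_aK ha hL hj
  have hC0 : 0 ≤ ctC (aK a L (max j 1)) w₁ (4 * kapCT (d + 1) a L) (d + 1) := ctC_nonneg (by exact_mod_cast hgap)
  have hK : latticeConst (d + 1) (2 * kapCT (d + 1) a L) = kwSum (d + 1) a L := rfl
  rw [hK]
  have hKW := (dressedConsts_nonneg (d := d) ha hL).2.1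
  gcongr

end Letters

/-! ## §3 The fully dressed covariances `C_v^{(j)} = (Δ^{(max j 1)}_{v} + aL⁻²Q*Q)⁻¹`: leaves, uniform decay, Lipschitz in the potential -/

section Covariances

variable {a m2 : ℝ} {L : ℕ} [NeZero L] {M : Fin (d + 1) → ℕ} [∀ μ, NeZero (M μ)]

/-- Part 6b's dressed covariance at the background `E = fullPert v` IS the covariance of the fully dressed tower. [cite: King1986, (4.32) p.674] -/
theorem kingCovE_fullPert (v : ∀ N : ℕ, Tor (fine N (fine L M)) → ℝ) (j : ℕ) :
    kingCovE a m2 L M (fullPert a m2 L M v) j = (kingTowerPot a m2 L M v j + kingBlock a L M)⁻¹ := by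
  rw [kingCovE, ← kingTower_add_fullPert v]
  rfl

/-- **(H1) FOR THE FULLY DRESSED TOWER**: `UniformCoercive (kingTowerPot v) (aL⁻²Q*Q) (γ₀ − c_E·V)`, `c_E = a²·ctCK²·kwSum·w₁` (6a's `uniformCoercive_add_of_decay`
on the derived letter). [cite: King1986, (4.33) p.674 (A = 0)] -/
theorem uniformCoercive_kingTowerPot (ha : 0 < a) (hm : 0 < m2) (hL : 2 ≤ L) {v : ∀ N : ℕ, Tor (fine N (fine L M)) → ℝ} {w₁ : ℝ}
    (hw₁0 : 0 ≤ w₁) (hw₁ : w₁ ≤ wbarK (d + 1) a L) (hv : ∀ N x, |v N x| ≤ w₁) :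
    UniformCoercive (kingTowerPot a m2 L M v) (kingBlock a L M)
      (gam0L (d + 1) a L - a ^ 2 * ctCK (d + 1) a L ^ 2 * kwSum (d + 1) a L * w₁ * V45 (d + 1) a L) := by
  obtain ⟨hCK, hKW, -⟩ := dressedConsts_nonneg (d := d) ha hL
  rw [← kingTower_add_fullPert v]
  exact uniformCoercive_add_of_decay (isPseudoMetric_tdistT (fine L M)) (kapCT_pos_le (d := d + 1) ha hL).1.le (by positivity)
    (uniformCoercive_kingTower ha hm hL) (uniformKernelDecay_fullPert ha hm hL hw₁ hv) (volumeSum_kingTorus ha hL)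

/-- **(H2) FOR THE FULLY DRESSED TOWER**: `UniformCTBound (kingTowerPot v) (aL⁻²Q*Q) tdistT κ′ (ρ + c_E·V) ρ_B`. [cite: King1986, (4.34) p.674 (A = 0)] -/
theorem uniformCTBound_kingTowerPot (ha : 0 < a) (hm : 0 < m2) (hL : 2 ≤ L) {v : ∀ N : ℕ, Tor (fine N (fine L M)) → ℝ} {w₁ : ℝ}
    (hw₁0 : 0 ≤ w₁) (hw₁ : w₁ ≤ wbarK (d + 1) a L) (hv : ∀ N x, |v N x| ≤ w₁) :
    UniformCTBound (kingTowerPot a m2 L M v) (kingBlock a L M) (tdistT (fine L M)) (kapCT (d + 1) a L)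
      (kingRho (d + 1) a L + a ^ 2 * ctCK (d + 1) a L ^ 2 * kwSum (d + 1) a L * w₁ * V45 (d + 1) a L) (kingRhoB (d + 1) a L) := by
  obtain ⟨hCK, hKW, -⟩ := dressedConsts_nonneg (d := d) ha hL
  rw [← kingTower_add_fullPert v]
  exact uniformCTBound_add (isPseudoMetric_tdistT (fine L M)) (kapCT_pos_le (d := d + 1) ha hL).1.le (by positivity)
    (uniformCTBound_kingTower ha hm hL) (uniformKernelDecay_fullPert ha hm hL hw₁ hv) (volumeSum_kingTorus ha hL)

/-- **(4.34)(i) FOR THE FULLY DRESSED COVARIANCES — UNIFORM DECAY AT EVERY LEVEL**: if the perturbation size `c_E = a²·ctCK²·kwSum·w₁` is at most 6b's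
threshold `c̄`, then `|(Δ^{(max j 1)}_{v} + aL⁻²Q*Q)⁻¹(x,y)| ≤ (4∕γ₀)·e^{−κ′|x−y|_T}` for all `j` (part 5's `inv_entry_decay_of_leaves` on the leaves above;
margin `≥ γ₀∕4` by 6b's `kingMargin`). [cite: King1986, (4.34) p.674 (A = 0 template)] -/
theorem kingCovPot_decay (ha : 0 < a) (hm : 0 < m2) (hL : 2 ≤ L) {v : ∀ N : ℕ, Tor (fine N (fine L M)) → ℝ} {w₁ : ℝ}
    (hw₁0 : 0 ≤ w₁) (hw₁ : w₁ ≤ wbarK (d + 1) a L) (hv : ∀ N x, |v N x| ≤ w₁)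
    (hsmall : a ^ 2 * ctCK (d + 1) a L ^ 2 * kwSum (d + 1) a L * w₁ ≤ kingCbar (d + 1) a L) (j : ℕ) (x y : Tor (fine L M)) :
    |(kingTowerPot a m2 L M v j + kingBlock a L M)⁻¹ x y| ≤ 4 / gam0L (d + 1) a L * Real.exp (-(kapCT (d + 1) a L * tdistT (fine L M) x y)) := by
  set cE := a ^ 2 * ctCK (d + 1) a L ^ 2 * kwSum (d + 1) a L * w₁ with hcE
  have hγ := gam0L_pos (d := d + 1) ha hL
  have hmargin := kingMargin (dd := d + 1) ha hL hsmall
  have hgap : kingRho (d + 1) a L + cE * V45 (d + 1) a L + kingRhoB (d + 1) a L < gam0L (d + 1) a L - cE * V45 (d + 1) a L := by linarith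
  have h := inv_entry_decay_of_leaves (isPseudoMetric_tdistT (fine L M)) hgap (kapCT_pos_le (d := d + 1) ha hL).1.le
    (uniformCoercive_kingTowerPot ha hm hL hw₁0 hw₁ hv) (uniformCTBound_kingTowerPot ha hm hL hw₁0 hw₁ hv) j x y
  refine h.trans (mul_le_mul_of_nonneg_right ?_ (Real.exp_pos _).le)
  rw [show (4 : ℝ) / gam0L (d + 1) a L = (gam0L (d + 1) a L / 4)⁻¹ by rw [inv_div]]
  exact inv_anti₀ (by positivity) (by linarith)

/-- **THE FULLY DRESSED COVARIANCES ARE LIPSCHITZ IN THE POTENTIAL AT EVERY LEVEL, WITH DECAY** (part 6b's `kingCovE_lipschitz` FIRED on the derived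
letter): for `sup|v| ≤ w₁ ≤ w̄` with `c_E = a²·ctCK²·kwSum·w₁ ≤ c̄`, at every level `j` and all sites
`|(Δ^{(max j 1)} + aL⁻²Q*Q)⁻¹(x,y) − (Δ^{(max j 1)}_{v} + aL⁻²Q*Q)⁻¹(x,y)| ≤ c_E·Λ_K·e^{−δ₄₅|x−y|_T}` — LINEAR in the potential's size, nonperturbative
(no first-order truncation of the dressing), uniform in `j`, the volume and `m²`. [cite: King1986, (4.39)–(4.41) p.675 (the mechanism, A = 0)] -/
theorem kingCovPot_lipschitz (ha : 0 < a) (hm : 0 < m2) (hL : 2 ≤ L) {v : ∀ N : ℕ, Tor (fine N (fine L M)) → ℝ} {w₁ : ℝ}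
    (hw₁0 : 0 ≤ w₁) (hw₁ : w₁ ≤ wbarK (d + 1) a L) (hv : ∀ N x, |v N x| ≤ w₁)
    (hsmall : a ^ 2 * ctCK (d + 1) a L ^ 2 * kwSum (d + 1) a L * w₁ ≤ kingCbar (d + 1) a L) (j : ℕ) (x y : Tor (fine L M)) :
    |(kingTower a m2 L M j + kingBlock a L M)⁻¹ x y - (kingTowerPot a m2 L M v j + kingBlock a L M)⁻¹ x y|
      ≤ (a ^ 2 * ctCK (d + 1) a L ^ 2 * kwSum (d + 1) a L * w₁) * kingLip (d + 1) a L
        * Real.exp (-(delta45 (d + 1) a L * tdistT (fine L M) x y)) := by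
  obtain ⟨hCK, hKW, -⟩ := dressedConsts_nonneg (d := d) ha hL
  rw [← kingCovE_fullPert v j]
  exact kingCovE_lipschitz ha hm hL (by positivity) hsmall (uniformKernelDecay_fullPert ha hm hL hw₁ hv) j x y

end Covariances

end Summit.QuantumFields.YangMills.BalabanUVNodes.N15.KingModel

end
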